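import Summits.QuantumFields.BalabanUV.Beta.GAN24.TaylorLamVertexPairing
import Summits.QuantumFields.BalabanUV.Beta.GAN24.TaylorMassLam
import Summits.QuantumFields.BalabanUV.Beta.GAN24.TaylorBlockSum
import Literature.MathematicalPhysics.QuantumFieldTheory.Balaban1983to89.Beta.BalabanCompositeJets

/-!
# `BalabanUV.Beta.GAN24.TaylorRowLamInner` — binder row G-an2-4 / (CONV-C), S-slot, road «S3-Taylor», Λ SHAPE rows, part 1 of 3:
# THE INNER IDENTITY — the vertex block-average against the Lagrange increment `lagrInc d Lc M N′`, rewritten EXACTLY through the vertex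
# pairing (`TaylorLamVertexPairing.vertexPair_eq`) into a one-channel vertex average with an on-lattice vertex leg and an on-lattice table

NOT IN PRINT; OUR PROOF ATTEMPT.  HONEST FRAMING (cell contract, verbatim): «discharging `BetaPertH` makes Bałaban's UV stability
UNCONDITIONAL — a real constructive-QFT result; it is NOT the continuum limit and NOT the Clay problem.»  HONEST DEPENDENCY (verbatim):
«continuum YM on T⁴ ⇐ BetaPertH ∧ nine spine estimates (0/9 proved); BetaPertH ⇐ (D1) ∧ (D4) ∧ CAP+tail; G-an2-4 gates asym, D1 and
NE2/3/4.»  [folklore] bookkeeping over LANDED modules BY NAME; no cited fact, no `def`, no `Prop` mirror; discharges NOTHING of (hS, hSall),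
the K-slot or BetaPertH by itself; NOT continuum, NOT Clay.  Unit `b2b-balaban-gan24-formalise-leaf-18` (gen 12; ROW-Λ = SHAPE row S3-L of
`GAN24/StencilSlotE3OfPieces.e3Shape_of_pieces`, cell journal l.4813), G-an2-4 formalisation swarm, 2026-08-20.

## Contents (generic `d`; member `N = N′·R`, level `M`, inner blocking `N′`)
§1 lattice sup-norm boxes as `piFinset`s (`mem_box_of_l1_le`, `l1_le_of_mem_box`, `card_box`); §2 the finite `Y`-range of leaf-11's lifted
constraint Hessian (`mem_boxY_of_avgLift_ne_zero`, from `TaylorMassLam.avgLift_hessFF_ne_zero`) and **`inner_eq`**: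
`Σ_{κ″} c·Σ'_u (e·wH_N κ″ κ′ (u − N•u′))·lagrInc d Lc M N′ κ″ u w y l l′
   = Σ_μ c·Σ'_v onLat N′ (e·𝒬ᵀ_R Φ̃_N^{(κ′,u′)} μ) v · onLat N′ (avgLift M (hessFF Lc μ ·)) v w y l l′`
(`cwsum` unfolded, the `u`-tsum exchanged with the finite `Y`-sum, the pairing evaluated by `vertexPair_eq`, re-packed through `cwsum_apply`).
Parts 2∕3: `GAN24/TaylorRowLamTable` (the hypotheses of `TaylorSandwich.sandwich_bound` for this sandwich), `GAN24/TaylorRowLam` (the bound,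
the power count `θ = Lc⁻¹`, row S3-L at `d = 3`).
-/

noncomputable section

open Finset
open scoped BigOperators
open Literature.MathematicalPhysics.QuantumFieldTheory
open Literature.MathematicalPhysics.QuantumFieldTheory.Balaban1983to89
open Literature.MathematicalPhysics.QuantumFieldTheory.Balaban1983to89.Beta
open Literature.Probability.LatticeModels (Torus.proj Torus.proj_apply)
open AffineAveraging (Site Form1 unitVec unitVec_apply)
open AffineReproduction (contourSumAdj)
open LatticeForm (quo)
open B12Sec2to5 (l1 l1_nonneg)
open ExpKernelCalculus (MKer Zl BiLoc l1_sub_triangle l1_sub_symm l1_natSmul)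
open OneStepResolventKernel (Fib KInv LocStencil proj_zsmul quo_zsmul eq_zsmul_quo_of_proj KInv_inr_inr_coarse)
open KernelSpecInstance (wH wΦ)
open KKTFluctuationKernel (GamΦ)
open InterLevelTransport (SLam avgLift cwsum cwsum_apply onLat onLat_zsmul onLat_off)
open BalabanStepJets (lamCoeffOf)
open BalabanCompositeJets (lagrInc)
open AveragingHessianKernels (hessFF ell)
open Summit.QuantumFields.BalabanUV.Beta.GAN24.TaylorLamVertexPairing (vertexPair_eq summable_wH_mul_lamCoeffOf quo_quo
  abs_contourSumAdj_le_exp)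
open Summit.QuantumFields.BalabanUV.Beta.GAN24.TaylorMassLam (abs_avgLift_hessFF_le avgLift_hessFF_ne_zero)
open Summit.QuantumFields.BalabanUV.Beta.GAN24.TaylorBlockSum (abs_ediv_sub_ediv_le nonneg_of_dominated)

namespace Summit.QuantumFields.BalabanUV.Beta.GAN24.TaylorRowLam

variable {d : ℕ}

/-! ## §1 Lattice boxes (sup-norm balls as `piFinset`s): membership from an `ℓ¹` bound, `ℓ¹` radius, cardinality -/

/-- [folklore] An `ℓ¹`-ball lies in the sup-norm box of the same radius. -/
theorem mem_box_of_l1_le (c w : Site (d + 1)) (Rb : ℕ) (h : l1 (w - c) ≤ Rb) :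
    w ∈ Fintype.piFinset fun j => Finset.Icc (c j - Rb) (c j + Rb) := by
  rw [Fintype.mem_piFinset]
  intro j
  rw [Finset.mem_Icc]
  have hj : |(((w - c) j : ℤ) : ℝ)| ≤ (Rb : ℝ) :=
    (Finset.single_le_sum (f := fun μ => |(((w - c) μ : ℤ) : ℝ)|) (fun μ _ => abs_nonneg _) (Finset.mem_univ j)).trans h
  rw [Pi.sub_apply, Int.cast_sub] at hj
  have hj' : |((w j : ℤ) : ℝ) - c j| ≤ (Rb : ℝ) := hj
  rw [abs_le] at hj'
  constructor
  · have : ((c j : ℤ) : ℝ) - Rb ≤ w j := by linarith [hj'.1]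
    exact_mod_cast this
  · have : ((w j : ℤ) : ℝ) ≤ c j + Rb := by linarith [hj'.2]
    exact_mod_cast this

/-- [folklore] The `ℓ¹` radius of the sup-norm box. -/
theorem l1_le_of_mem_box {c w : Site (d + 1)} {Rb : ℕ} (h : w ∈ Fintype.piFinset fun j => Finset.Icc (c j - Rb) (c j + Rb)) :
    l1 (w - c) ≤ ((d : ℝ) + 1) * Rb := by
  rw [Fintype.mem_piFinset] at h
  unfold B12Sec2to5.l1
  calc ∑ j, |(((w - c) j : ℤ) : ℝ)| ≤ ∑ _j : Fin (d + 1), (Rb : ℝ) := Finset.sum_le_sum fun j _ => by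
        have hj := Finset.mem_Icc.mp (h j)
        rw [Pi.sub_apply, Int.cast_sub, abs_le]
        constructor
        · have : ((c j : ℤ) : ℝ) - Rb ≤ w j := by exact_mod_cast hj.1
          linarith
        · have : ((w j : ℤ) : ℝ) ≤ c j + Rb := by exact_mod_cast hj.2
          linarith
    _ = ((d : ℝ) + 1) * Rb := by simp [mul_comm]

/-- [folklore] The sup-norm box has `(2R+1)^{d+1}` points. -/
theorem card_box (c : Site (d + 1)) (Rb : ℕ) :
    (Fintype.piFinset fun j => Finset.Icc (c j - Rb) (c j + Rb)).card = (2 * Rb + 1) ^ (d + 1) := by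
  rw [Fintype.card_piFinset, Finset.prod_congr rfl fun j _ => show (Finset.Icc (c j - Rb) (c j + Rb)).card = 2 * Rb + 1 by
    rw [Int.card_Icc]; omega]
  rw [Finset.prod_const, Finset.card_univ, Fintype.card_fin]

/-! ## §2 The inner identity: the vertex block-average against the Lagrange increment, rewritten through the exact vertex pairing -/

section Inner

variable {Lc : ℕ} [NeZero Lc]

/-- [folklore] The finite `Y`-range of the lifted constraint Hessian seen from a fine point `w`: if `avgLift M (hessFF Lc μ Y) w y ≠ 0` then
`Y` lies in the sup-norm box of radius `4(d+1)+1` around `quo (M·Lc) w` (leaf-11's support radius `2(d+1)(Lc+1)M ≤ 4(d+1)·(M·Lc)`). -/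
theorem mem_boxY_of_avgLift_ne_zero (M : ℕ) [NeZero M] {μ : Fin (d + 1)} {Y w y : Site (d + 1)} {a b : Fib d}
    (h : avgLift M (hessFF Lc μ Y) w y a b ≠ 0) :
    Y ∈ Fintype.piFinset fun j => Finset.Icc (quo (M * Lc) w j - (4 * (d + 1) + 1 : ℕ)) (quo (M * Lc) w j + (4 * (d + 1) + 1 : ℕ)) := by
  have hw := (avgLift_hessFF_ne_zero M (Nat.one_le_iff_ne_zero.2 (NeZero.ne Lc)) h).1
  have hML : 0 < M * Lc := Nat.mul_pos (Nat.pos_of_ne_zero (NeZero.ne M)) (Nat.pos_of_ne_zero (NeZero.ne Lc))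
  haveI : NeZero (M * Lc) := ⟨hML.ne'⟩
  rw [Fintype.mem_piFinset]
  intro j
  rw [Finset.mem_Icc]
  -- coordinate `j`: `|w j − (M Lc) Y j| ≤ 2(d+1)(Lc+1)M`, hence `|quo (M Lc) w j − Y j| ≤ 2(d+1)(Lc+1)M/(M Lc) + 1 ≤ 4(d+1) + 1`
  have hc : |(((w - ((M * Lc : ℕ) : ℤ) • Y) j : ℤ) : ℝ)| ≤ 2 * ((d : ℝ) + 1) * (Lc + 1) * M :=
    (Finset.single_le_sum (f := fun μ => |(((w - ((M * Lc : ℕ) : ℤ) • Y) μ : ℤ) : ℝ)|) (fun μ _ => abs_nonneg _)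
      (Finset.mem_univ j)).trans hw
  have hq := abs_ediv_sub_ediv_le hML (w j) (((M * Lc : ℕ) : ℤ) * Y j)
  have hY : ((M * Lc : ℕ) : ℤ) * Y j / ((M * Lc : ℕ) : ℤ) = Y j := by
    rw [mul_comm]; exact Int.mul_ediv_cancel _ (by exact_mod_cast hML.ne')
  rw [hY] at hq
  have hc' : |(((w j - ((M * Lc : ℕ) : ℤ) * Y j : ℤ)) : ℝ)| ≤ 2 * ((d : ℝ) + 1) * (Lc + 1) * M := by
    simpa only [Pi.sub_apply, Pi.smul_apply, smul_eq_mul] using hc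
  have hML' : (0 : ℝ) < ((M * Lc : ℕ) : ℝ) := by exact_mod_cast hML
  have hratio : 2 * ((d : ℝ) + 1) * (Lc + 1) * M / ((M * Lc : ℕ) : ℝ) ≤ 4 * ((d : ℝ) + 1) := by
    have hM : (0 : ℝ) < M := by exact_mod_cast Nat.pos_of_ne_zero (NeZero.ne M)
    have hL : (1 : ℝ) ≤ Lc := by exact_mod_cast (Nat.one_le_iff_ne_zero.2 (NeZero.ne Lc))
    rw [div_le_iff₀ hML']
    have e : ((M * Lc : ℕ) : ℝ) = (M : ℝ) * Lc := by push_cast; ring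
    rw [e]
    nlinarith [mul_nonneg (show (0 : ℝ) ≤ 2 * ((d : ℝ) + 1) * M by positivity) (show (0 : ℝ) ≤ (Lc : ℝ) - 1 by linarith)]
  have hfin : (((|w j / ((M * Lc : ℕ) : ℤ) - Y j| : ℤ)) : ℝ) ≤ 4 * ((d : ℝ) + 1) + 1 := by
    refine hq.trans ?_
    have := div_le_div_of_nonneg_right hc' hML'.le
    linarith
  have hfin' : |w j / ((M * Lc : ℕ) : ℤ) - Y j| ≤ ((4 * (d + 1) + 1 : ℕ) : ℤ) := by
    have e : (((4 * (d + 1) + 1 : ℕ) : ℤ) : ℝ) = 4 * ((d : ℝ) + 1) + 1 := by push_cast; ring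
    exact_mod_cast (hfin.trans_eq e.symm)
  rw [abs_le] at hfin'
  simp only [quo]
  constructor <;> omega

/-- [folklore] **THE INNER IDENTITY.**  Inside the Λ unit sandwich of `E3UnitSplitLevels.e3Lam_unit_split` (member `N = N′·R`, level
`M`, inner blocking `N′ = M·Lc`), the vertex block-average against the Lagrange increment equals a one-channel vertex average whose vertex leg
is the on-lattice extension of `N^{d+2}·𝒬ᵀ_R Φ̃_N^{(κ′,u′)}` and whose table is the on-lattice family of lifted constraint Hessians:
`Σ_{κ″} N^{−(d+1)} Σ'_u H̃_N(κ″; u − N•u′)·lagrInc(κ″,u)(w,y;l,l′) = Σ_μ N^{−(d+1)} Σ'_v onLat N′ (N^{d+2}·𝒬ᵀ_R φ μ) v · onLat N′ (avgLift M (hessFF Lc μ ·)) v w y l l′`. -/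
theorem inner_eq {N N' M R : ℕ} [NeZero N] [NeZero N'] [NeZero M] (hN : N = N' * R)
    (κ' : Fin (d + 1)) (u' w y : Site (d + 1)) (l l' : Fin (d + 1)) :
    ∑ κ'' : Fin (d + 1), ((N : ℝ) ^ (d + 1))⁻¹ * ∑' u : Site (d + 1),
        ((N : ℝ) ^ (d + 2) * wH (N := N) κ'' κ' (u - (N : ℤ) • u')) * lagrInc d Lc M N' κ'' u w y (Sum.inl l) (Sum.inl l') =
      ∑ μ : Fin (d + 1), ((N : ℝ) ^ (d + 1))⁻¹ * ∑' v : Site (d + 1),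
        onLat N' (fun Y => (N : ℝ) ^ (d + 2) * contourSumAdj R (fun κ q => wΦ (N := N) κ κ' (q - u')) μ Y) v *
          onLat N' (fun Y => avgLift M (hessFF Lc μ Y)) v w y (Sum.inl l) (Sum.inl l') := by
  -- the finite `Y`-range seen from `w`
  set SY : Finset (Site (d + 1)) :=
    Fintype.piFinset fun j => Finset.Icc (quo (M * Lc) w j - (4 * (d + 1) + 1 : ℕ)) (quo (M * Lc) w j + (4 * (d + 1) + 1 : ℕ)) with hSY
  have hsupp : ∀ μ Y, Y ∉ SY → avgLift M (hessFF Lc μ Y) w y (Sum.inl l) (Sum.inl l') = 0 := by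
    intro μ Y hY
    by_contra h
    exact hY (mem_boxY_of_avgLift_ne_zero M h)
  -- abbreviations
  set c : ℝ := ((N : ℝ) ^ (d + 1))⁻¹ with hc
  set h : Fin (d + 1) → Site (d + 1) → ℝ := fun κ'' u => (N : ℝ) ^ (d + 2) * wH (N := N) κ'' κ' (u - (N : ℤ) • u') with hh
  set lam : Fin (d + 1) → Site (d + 1) → Fin (d + 1) → Site (d + 1) → ℝ :=
    fun μ Y κ'' u => lamCoeffOf (KInv (N := N') (d := d)) N' μ Y κ'' u with hlam
  set aL : Fin (d + 1) → Site (d + 1) → ℝ := fun μ Y => avgLift M (hessFF Lc μ Y) w y (Sum.inl l) (Sum.inl l') with haL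
  set ψ : Fin (d + 1) → Site (d + 1) → ℝ :=
    fun μ Y => (N : ℝ) ^ (d + 2) * contourSumAdj R (fun κ q => wΦ (N := N) κ κ' (q - u')) μ Y with hψ
  -- (1) the increment at field legs, as a finite `Y`-sum
  have hinc : ∀ κ'' u, lagrInc d Lc M N' κ'' u w y (Sum.inl l) (Sum.inl l') = -∑ μ, ∑ Y ∈ SY, lam μ Y κ'' u * aL μ Y := by
    intro κ'' u
    change SLam N' (lamCoeffOf (KInv (N := N') (d := d)) N') (fun μ Y => avgLift M (hessFF Lc μ Y)) κ'' u w y (Sum.inl l) (Sum.inl l')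
      = _
    simp only [SLam]
    congr 1
    refine Finset.sum_congr rfl fun μ _ => ?_
    rw [cwsum_apply]
    exact tsum_eq_sum fun Y hY => by simp only [hsupp μ Y hY, mul_zero]
  -- (2) summability of each `u`-term
  have hsum : ∀ κ'' μ Y, Summable fun u => h κ'' u * (lam μ Y κ'' u * aL μ Y) := by
    intro κ'' μ Y
    have hs := (summable_wH_mul_lamCoeffOf (N := N) (N' := N') κ' μ κ'' u' Y).mul_left ((N : ℝ) ^ (d + 2) * aL μ Y)
    refine hs.congr fun u => ?_
    simp only [hh, hlam]; ring
  -- (3) the exact pairing, per `(μ, Y)`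
  have hpair : ∀ μ Y, ∑ κ'', ∑' u, h κ'' u * lam μ Y κ'' u = -ψ μ Y := by
    intro μ Y
    have hv := vertexPair_eq (d := d) (N := N) (N' := N') (R := R) hN κ' μ u' Y
    calc ∑ κ'', ∑' u, h κ'' u * lam μ Y κ'' u
        = ∑ κ'', (N : ℝ) ^ (d + 2) * ∑' u, wH (N := N) κ'' κ' (u - (N : ℤ) • u') * lamCoeffOf (KInv (N := N') (d := d)) N' μ Y κ'' u := by
          refine Finset.sum_congr rfl fun κ'' _ => ?_
          rw [← tsum_mul_left]
          exact tsum_congr fun u => by simp only [hh, hlam]; ring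
      _ = _ := by rw [← Finset.mul_sum, hv, hψ]; ring
  -- (4) step by step
  have s1 : ∀ κ'', ∑' u, h κ'' u * lagrInc d Lc M N' κ'' u w y (Sum.inl l) (Sum.inl l')
      = ∑ μ, ∑ Y ∈ SY, ∑' u, -(h κ'' u * (lam μ Y κ'' u * aL μ Y)) := by
    intro κ''
    calc ∑' u, h κ'' u * lagrInc d Lc M N' κ'' u w y (Sum.inl l) (Sum.inl l')
        = ∑' u, ∑ μ, ∑ Y ∈ SY, -(h κ'' u * (lam μ Y κ'' u * aL μ Y)) := by
          refine tsum_congr fun u => ?_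
          rw [hinc, mul_neg, Finset.mul_sum, ← Finset.sum_neg_distrib]
          refine Finset.sum_congr rfl fun μ _ => ?_
          rw [Finset.mul_sum, ← Finset.sum_neg_distrib]
      _ = ∑ μ, ∑ Y ∈ SY, ∑' u, -(h κ'' u * (lam μ Y κ'' u * aL μ Y)) := by
          rw [Summable.tsum_finsetSum (fun μ _ => summable_sum fun Y _ => (hsum κ'' μ Y).neg)]
          exact Finset.sum_congr rfl fun μ _ => Summable.tsum_finsetSum (fun Y _ => (hsum κ'' μ Y).neg)
  have s2 : ∀ μ Y, ∑ κ'', c * ∑' u, -(h κ'' u * (lam μ Y κ'' u * aL μ Y)) = c * (ψ μ Y * aL μ Y) := by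
    intro μ Y
    have e : ∀ κ'', ∑' u, -(h κ'' u * (lam μ Y κ'' u * aL μ Y)) = -((∑' u, h κ'' u * lam μ Y κ'' u) * aL μ Y) := by
      intro κ''
      rw [tsum_neg, ← tsum_mul_right]
      exact congrArg Neg.neg (tsum_congr fun u => by ring)
    simp_rw [e]
    rw [← Finset.mul_sum,
      show (∑ κ'', -((∑' u, h κ'' u * lam μ Y κ'' u) * aL μ Y)) = -((∑ κ'', ∑' u, h κ'' u * lam μ Y κ'' u) * aL μ Y) by
        rw [Finset.sum_mul, Finset.sum_neg_distrib], hpair]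
    ring
  calc ∑ κ'', c * ∑' u, h κ'' u * lagrInc d Lc M N' κ'' u w y (Sum.inl l) (Sum.inl l')
      = ∑ κ'', ∑ μ, ∑ Y ∈ SY, c * ∑' u, -(h κ'' u * (lam μ Y κ'' u * aL μ Y)) := by
        refine Finset.sum_congr rfl fun κ'' _ => ?_
        rw [s1, Finset.mul_sum]
        exact Finset.sum_congr rfl fun μ _ => Finset.mul_sum _ _ _
    _ = ∑ μ, ∑ Y ∈ SY, ∑ κ'', c * ∑' u, -(h κ'' u * (lam μ Y κ'' u * aL μ Y)) := by
        rw [Finset.sum_comm]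
        exact Finset.sum_congr rfl fun μ _ => Finset.sum_comm
    _ = ∑ μ, ∑ Y ∈ SY, c * (ψ μ Y * aL μ Y) := by
        refine Finset.sum_congr rfl fun μ _ => Finset.sum_congr rfl fun Y _ => s2 μ Y
    _ = ∑ μ, c * ∑ Y ∈ SY, ψ μ Y * aL μ Y := by
        refine Finset.sum_congr rfl fun μ _ => ?_
        rw [Finset.mul_sum]
    _ = _ := by
        refine Finset.sum_congr rfl fun μ _ => ?_
        congr 1
        have hcw := cwsum_apply (N := N') (fun Y => ψ μ Y) (fun Y => avgLift M (hessFF Lc μ Y)) w y (Sum.inl l) (Sum.inl l')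
        unfold InterLevelTransport.cwsum OneStepResolventKernel.wsum at hcw
        rw [hψ] at hcw
        rw [hcw]
        symm
        exact tsum_eq_sum fun Y hY => by simp only [hsupp μ Y hY, mul_zero]

end Inner

end Summit.QuantumFields.BalabanUV.Beta.GAN24.TaylorRowLam
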